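import Summits.BirchSwinnertonDyer.BirchSwinnertonDyer.Theorems.RamifiedHeegnerPairLeafRankZeroUpperAtThreeSocket
import Summits.BirchSwinnertonDyer.BirchSwinnertonDyer.Theorems.RamifiedHeegnerPairGss2LowerAtThreeRankZeroJointLowerCertificate
import Summits.BirchSwinnertonDyer.BirchSwinnertonDyer.Theorems.SchneiderFreeUpperSocketsSplit
import Summits.BirchSwinnertonDyer.Rank1Residual.O5.HeegnerTwistTamagawaThree
import Summits.BirchSwinnertonDyer.Rank1Residual.X11b.TwistTransportIrr
import Literature.NumberTheory.EllipticCurves.Rank1Residual.PrintShape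
import Literature.NumberTheory.EllipticCurves.IsogenyIdProofs
import HarnessLib

/-!
# Route `RamifiedHeegnerPair`, U-side (items 26022 / 26024) — the twist-unit datum on the Gss2 leaf IS an L-value inequality:
# `TwistUnitFieldAt W 3` ⟺ a Heegner twist with `ord₃ (L(E^{(d)},1)/Ω_{E^{(d)}}) ≤ ord₃ ∏_ℓ c_ℓ(E)` (certificate shape)

HONEST FRAMING. Theorems only; helper file (`--supports stmt-BirchSwinnertonDyer-26022`); nothing is booked, no item is closed, BSD
is not proved for any curve. Lead prover bsd-line-rhp-p2 g7, 2026-08-28. Companion of `…LeafRankOneUpperAtThreeTwistUnit.lean` (p630223: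
U₁ ⟸ PUB⁺ ∧ S2 ∧ Σ★″ ∧ TU₁ with TU₁ := ∀ rank-one leaf `W`, `SchneiderFree.Upper.TwistUnitFieldAt W 3`).

WHAT. On the leaf (non-CM, `Addv W 3`, `SubGss W 3`) the door's split twist-unit datum is EXACTLY an inequality between two
modular-symbol rationals, which is what a kit census / a tribunal rung has to certify per class:

* (rank-zero bookkeeping reused BY NAME from rhp-p1's `…Gss2LowerAtThreeRankZeroJointLowerCertificate`: `RamifiedPairLowerBound.shaAn_eq_
  of_lOne_div_eq_of_rankZero` — `#Ш_an(V) = q₀ · t_V² / ∏c(V)` for `q₀ = L(V,1)/Ω_V`, `Reg = 1` by GZK — and `…padicValRat_mul_sq_div`.)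
* §1 `padicValRat_shaAn_heegnerTwist_three` — for a Heegner twist `Wd = Cd • W^{(d_K)}` (`K` imaginary quadratic, `d_K` odd, Heegner for
  `N_W`) of a leaf curve, of analytic rank `0`: `ord₃ #Ш_an(Wd) = ord₃ (L(Wd,1)/Ω_{Wd}) − ord₃ ∏_ℓ c_ℓ(W)` — the twist has no rational
  `3`-torsion (`E[3]` irreducible on the leaf, transported to the twist) and the SAME Tamagawa `3`-part as `W` (every `ℓ ∣ N` splits in
  `K`, so `χ_{d_K}` is trivial on `G_{ℚ_ℓ}`; the primes of `d_K` contribute `c ∈ {1, 2, 4}`: `O5.TwistTamagawa.padicValNat_tamagawaProduct_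
  twist_of_heegner_three`).
* §2 `twistUnitFieldAt_three_of_padicValRat_le` — CERTIFICATE ⟹ DATUM: a Heegner field `K` of `W` and a globally minimal model `Wd` of
  `W^{(d_K)}` with `L(Wd,1)/Ω_{Wd} = q₀ ≠ 0` and `ord₃ q₀ ≤ ord₃ ∏c_ℓ(W)` give `SchneiderFree.Upper.TwistUnitFieldAt W 3` (unit member = `W`
  itself); and `padicValRat_le_of_twistUnit_model` — DATUM ⟹ CERTIFICATE at the same field and model (so nothing weaker would do).

So TU₁ at a class = «some Heegner discriminant `d` (odd, `3 ∤ d`, every `ℓ ∣ N` split, `L(E^{(d)},1) ≠ 0`) has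
`ord₃ (L(E^{(d)},1)/Ω) ≤ ord₃ ∏c_ℓ(E)`» — one exact modular-symbol computation per candidate `d`. Not print as a ∀-statement (see the
companion's docstring); nothing asserted here. References: [cite: Miller2011LMS, §1 and Def. 1.1 (arXiv:1010.2431 p. 3)]
[cite: Mazur1977, Ch. III §5, p. 157] [cite: KrizLi2019, Thm. 1.20] [cite: GrossZagier1986, Thm. I.(6.3)] [cite: SilvermanAEC2009, §VIII.9 and C.16].
-/

-- D-0017: single-problem summit, so `Summit.BirchSwinnertonDyer.BirchSwinnertonDyer.…` repeats a namespace BY DESIGN.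
set_option linter.dupNamespace false
set_option autoImplicit false

noncomputable section

open scoped Classical NumberField

open WeierstrassCurve IsDedekindDomain IsDedekindDomain.HeightOneSpectrum NumberField
  Rat.HeightOneSpectrum Literature Literature.NumberTheory.EllipticCurves
  Literature.NumberTheory.EllipticCurves.ModularForms
  Literature.NumberTheory.EllipticCurves.Rank1Residual
  Literature.NumberTheory.EllipticCurves.Rank1Residual.Typed
  Literature.NumberTheory.EllipticCurves.KrizLi2019
  Literature.NumberTheory.QuadraticFields
  Summit.BirchSwinnertonDyer.Rank1Residual
  Summit.BirchSwinnertonDyer.Rank1Residual.Additive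
  Summit.BirchSwinnertonDyer.Rank1Residual.X11b.Three
  Summit.BirchSwinnertonDyer.BirchSwinnertonDyer.Theses.RamifiedHeegnerPair
  Summit.BirchSwinnertonDyer.BirchSwinnertonDyer.Theorems
  Summit.BirchSwinnertonDyer.BirchSwinnertonDyer.Theorems.SchneiderFree

namespace Summit.BirchSwinnertonDyer.BirchSwinnertonDyer.Theorems.RamifiedPairUpperBound

/-! ## §1 A Heegner twist of a leaf curve: `ord₃ #Ш_an(Wd) = ord₃ (L(Wd,1)/Ω) − ord₃ ∏c(W)` -/

/-- **The `3`-adic valuation of `#Ш_an` of a rank-zero Heegner twist of a leaf curve.** For `W/ℚ` globally minimal on the leaf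
(`Addv W 3`, `SubGss W 3`), `K` imaginary quadratic with odd `d_K` satisfying the Heegner hypothesis for `N_W`, and a globally minimal
model `Wd = Cd • W^{(d_K)}` of analytic rank `0` with `L(Wd,1)/Ω_{Wd} = q₀ ≠ 0`:
`#Ш_an(Wd) = q₀ · t² / ∏c(Wd)` and `ord₃ #Ш_an(Wd) = ord₃ q₀ − ord₃ ∏_ℓ c_ℓ(W)`. Ingredients: `Wd[3]` irreducible (from `W[3]`, leaf ⇒
`classX4_three_of_addv_of_subGss`, transported by `hasIrreducibleModPGaloisRep_twist_model`) so `3 ∤ t_{Wd}` (Mazur, `padicValNat_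
torsionOrder_eq_zero_of_irreducible`); `ord₃ ∏c(Wd) = ord₃ ∏c(W)` (`O5.TwistTamagawa.padicValNat_tamagawaProduct_twist_of_heegner_three`,
`3 ∤ d_K` because `3 ∣ N_W` splits). [cite: Mazur1977, Ch. III §5, p. 157] [cite: Miller2011LMS, §1 and Def. 1.1 (arXiv:1010.2431 p. 3)] -/
theorem padicValRat_shaAn_heegnerTwist_three (hGZK : rank_eq_analyticRank_of_analyticRank_le_one)
    (W : WeierstrassCurve ℚ) [W.IsElliptic] [W.IsGloballyMinimal] (hadd : Addv W 3) (hsub : SubGss W 3)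
    (K : Type) [Field K] [NumberField K] (hK : IsImaginaryQuadratic K)
    (hHN : SatisfiesHeegnerHypothesis (W.conductorNorm ℤ) K)
    (Wd : WeierstrassCurve ℚ) [Wd.IsElliptic] [Wd.IsGloballyMinimal] (Cd : VariableChange ℚ)
    (hWd : Cd • W.quadraticTwist (NumberField.discr K : ℚ) = Wd) (hrd : Wd.analyticRank = 0)
    {q0 : ℚ} (hq0 : Wd.entireLFunction 1 / (Wd.realPeriodRat : ℂ) = (q0 : ℂ)) (hq0ne : q0 ≠ 0) :
    ∃ q : ℚ, shaAn Wd = (q : ℂ) ∧ padicValRat 3 q = padicValRat 3 q0 - padicValNat 3 W.tamagawaProduct := by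
  have hirr : W.HasIrreducibleModPGaloisRep 3 := (classX4_three_of_addv_of_subGss W hadd hsub).2.2
  have hirrd : Wd.HasIrreducibleModPGaloisRep 3 := X11b.hasIrreducibleModPGaloisRep_twist_model W 3 K hK.1 hirr Cd hWd
  have htd : padicValNat 3 Wd.torsionOrder = 0 := padicValNat_torsionOrder_eq_zero_of_irreducible Wd 3 hirrd
  have h3N : 3 ∣ W.conductorNorm ℤ :=
    (W.dvd_conductorNorm_iff_not_hasGoodReductionAtPrime 3).mpr (not_good_of_addv W 3 hadd)
  have h3d : ¬ (3 : ℤ) ∣ NumberField.discr K :=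
    (X11b.Three.not_dvd_discr_and_not_dvd_torsionOrder_of_heegner hK hHN (by decide) h3N).1
  have htam : padicValNat 3 Wd.tamagawaProduct = padicValNat 3 W.tamagawaProduct :=
    O5.TwistTamagawa.padicValNat_tamagawaProduct_twist_of_heegner_three W Wd K hK hHN h3d Cd hWd
  refine ⟨q0 * (Wd.torsionOrder : ℚ) ^ 2 / (Wd.tamagawaProduct : ℚ),
    RamifiedPairLowerBound.shaAn_eq_of_lOne_div_eq_of_rankZero hGZK Wd hrd hq0, ?_⟩
  rw [RamifiedPairLowerBound.padicValRat_mul_sq_div 3 hq0ne Wd.torsionOrder_pos_holds Wd.tamagawaProduct_pos_holds, htd, htam]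
  push_cast
  ring

/-! ## §2 Certificate ⟺ datum -/

/-- **CERTIFICATE ⟹ DATUM.** For a leaf curve `W` (`Addv W 3`, `SubGss W 3`), a Heegner field `K` (imaginary quadratic, odd `d_K`, Heegner
hypothesis for `N_W`) and a globally minimal model `Wd = Cd • W^{(d_K)}` with `L(Wd,1)/Ω_{Wd} = q₀ ≠ 0` (so `L(W^{(d_K)},1) ≠ 0` and `r_an(Wd) = 0`,
Version L `hmod`) and `ord₃ q₀ ≤ ord₃ ∏_ℓ c_ℓ(W)`: the door's split twist-unit datum `SchneiderFree.Upper.TwistUnitFieldAt W 3` holds, with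
unit member `W` itself (`IsIsogenous.refl`). §1 + bookkeeping. Nothing asserted about any curve. [cite: KrizLi2019, Thm. 1.20]
[cite: Miller2011LMS, §1 and Def. 1.1 (arXiv:1010.2431 p. 3)] [cite: GrossZagier1986, Thm. I.(6.3)] -/
theorem twistUnitFieldAt_three_of_padicValRat_le (hGZK : rank_eq_analyticRank_of_analyticRank_le_one)
    (hmod : hasEntireLFunction_rat)
    (W : WeierstrassCurve ℚ) [W.IsElliptic] [W.IsGloballyMinimal] (hadd : Addv W 3) (hsub : SubGss W 3)
    (K : Type) [Field K] [NumberField K] (hK : IsImaginaryQuadratic K) (hodd : Odd (NumberField.discr K))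
    (hHN : SatisfiesHeegnerHypothesis (W.conductorNorm ℤ) K)
    (Wd : WeierstrassCurve ℚ) [Wd.IsElliptic] [Wd.IsGloballyMinimal] (Cd : VariableChange ℚ)
    (hWd : Cd • W.quadraticTwist (NumberField.discr K : ℚ) = Wd)
    {q0 : ℚ} (hq0 : Wd.entireLFunction 1 / (Wd.realPeriodRat : ℂ) = (q0 : ℂ)) (hq0ne : q0 ≠ 0)
    (hv : padicValRat 3 q0 ≤ padicValNat 3 W.tamagawaProduct) :
    Upper.TwistUnitFieldAt W 3 := by
  have hΩ : (Wd.realPeriodRat : ℂ) ≠ 0 := by exact_mod_cast Wd.realPeriodRat_pos_holds.ne'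
  have hLd : Wd.entireLFunction 1 ≠ 0 := by
    intro h
    rw [h, zero_div] at hq0
    exact hq0ne (by exact_mod_cast hq0.symm)
  have hD0 : (NumberField.discr K : ℚ) ≠ 0 := by exact_mod_cast NumberField.discr_ne_zero K
  haveI hEt : (W.quadraticTwist (NumberField.discr K : ℚ)).IsElliptic := W.isElliptic_quadraticTwist hD0
  have hLt : (W.quadraticTwist (NumberField.discr K : ℚ)).entireLFunction 1 ≠ 0 := by
    rw [← hWd, entireLFunction_smul] at hLd
    exact hLd
  have hrd : Wd.analyticRank = 0 := (Wd.analyticRank_eq_zero_iff_holds (hmod Wd)).2 hLd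
  obtain ⟨q, hq, hvq⟩ := padicValRat_shaAn_heegnerTwist_three hGZK W hadd hsub K hK hHN Wd Cd hWd hrd hq0 hq0ne
  exact ⟨K, inferInstance, inferInstance, W, Wd, inferInstance, inferInstance, inferInstance, inferInstance, hK, hodd, hHN,
    hLt, IsIsogenous.refl_holds W, ⟨Cd, hWd⟩, q, hq, by rw [hvq]; linarith⟩

/-- **DATUM ⟹ CERTIFICATE (at the same field and model).** Conversely, if `#Ш_an(Wd) = q` with `ord₃ q ≤ 0` for a rank-zero Heegner
twist model `Wd = Cd • W^{(d_K)}` of a leaf curve with `L(Wd,1)/Ω_{Wd} = q₀ ≠ 0`, then `ord₃ q₀ ≤ ord₃ ∏_ℓ c_ℓ(W)` (the rational with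
`#Ш_an(Wd) = q` is unique). So the twist-unit census asks for nothing weaker than §2's inequality. [cite: Miller2011LMS, §1 and Def. 1.1 (arXiv:1010.2431 p. 3)] -/
theorem padicValRat_le_of_twistUnit_model (hGZK : rank_eq_analyticRank_of_analyticRank_le_one)
    (W : WeierstrassCurve ℚ) [W.IsElliptic] [W.IsGloballyMinimal] (hadd : Addv W 3) (hsub : SubGss W 3)
    (K : Type) [Field K] [NumberField K] (hK : IsImaginaryQuadratic K)
    (hHN : SatisfiesHeegnerHypothesis (W.conductorNorm ℤ) K)
    (Wd : WeierstrassCurve ℚ) [Wd.IsElliptic] [Wd.IsGloballyMinimal] (Cd : VariableChange ℚ)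
    (hWd : Cd • W.quadraticTwist (NumberField.discr K : ℚ) = Wd) (hrd : Wd.analyticRank = 0)
    {q0 : ℚ} (hq0 : Wd.entireLFunction 1 / (Wd.realPeriodRat : ℂ) = (q0 : ℂ)) (hq0ne : q0 ≠ 0)
    {q : ℚ} (hq : shaAn Wd = (q : ℂ)) (hvq : padicValRat 3 q ≤ 0) :
    padicValRat 3 q0 ≤ padicValNat 3 W.tamagawaProduct := by
  obtain ⟨q', hq', hvq'⟩ := padicValRat_shaAn_heegnerTwist_three hGZK W hadd hsub K hK hHN Wd Cd hWd hrd hq0 hq0ne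
  have hqq : q = q' := by
    have : ((q : ℂ)) = (q' : ℂ) := by rw [← hq, hq']
    exact_mod_cast this
  subst hqq
  rw [hvq'] at hvq
  linarith

end Summit.BirchSwinnertonDyer.BirchSwinnertonDyer.Theorems.RamifiedPairUpperBound

end
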